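import Mathlib
import HarnessLib
import Literature.Analysis.FluidPDE.SelfSimilar
import Literature.Analysis.FluidPDE.ClassicalSolution
import Literature.Analysis.FluidPDE.EnstrophySplitting
import Literature.Analysis.FluidPDE.NSBoundedMildSmoothing
import Literature.Analysis.FluidPDE.KNSSLocalSmoothingHolds
import Literature.Analysis.UnboundedOperators.HeatKernel
import Summits.NavierStokesRegularity.NavierStokesRegularity.Theorems.LocalSineTubeDoorProfileAlignedWindowRigidityAncient

/-!
# K2 `PoloidalWindowRigidity` (stmt-NavierStokesRegularity-19708) — SPACE–TIME CLASS RATES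
# `‖Dₓᵏ ∂ₜˡ v(t)‖ ≤ K_{kl}/√(−t)^{1+k+2l}` with ONE constant for the whole Type-I mild class

Cell ns-regularity-ideate, seat nsreg-p7 gen 7 (third worker under the K2 lead ns-poloidal-K2-p1; asked by the stub
worker ns-poloidal-K2-p2 g2, 2026-08-27T05:31Z: «is there a tree bound `sup_x ‖∂ₜv(t,x)‖ ≤ C_t/(−t)^{3/2}` for the
class?»).  For a profile of the route's Type-I class (rate `‖v(t,x)‖ ≤ C/√(−t)`, continuity on the open slab,
unit-viscosity Oseen–Duhamel identity between negative times) and every pair `(k, l)` of a space order and a time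
order there is ONE constant `K = K(C,k,l)` with

  `‖Dₓᵏ (∂ₜˡ v)(t, y)‖ ≤ K / √(−t)^{k + 2l + 1}`   for all `t < 0`, `y ∈ ℝ³`

(`exists_spaceTime_rate_of_class`; the mixed derivative is `iteratedFDeriv ℝ k (fun y => iteratedDeriv l (v · y) t) y`,
the normal form of the local smoothing fact).  Proof = the route of the tree's `…ClassRate.exists_fderiv_rate_of_class`
(`k = 1`) and `…VerticalMean.exists_iteratedFDeriv_two_rate_of_class` (`k = 2`) run for general `(k,l)`: the UNIFORM
constants `(ε, C_L)` of KNSS 2009 Prop. 4.1 (`knss2009_local_smoothing_holds E k l`), restart at the datum time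
`s' = (1+δ)t`, `δ = ε/(4C'²)`, `C' = max C 1`, bound `M = C'√2/√(−t)` on `(s', t/2)`; the local smooth solution lives on
`(s', s' + ε/M²) ∋ t` and coincides with `v` there pointwise ON AN OPEN TIME INTERVAL AROUND `t`
(`exists_local_smooth_representative` + the Duhamel identity from `s'`), so its time derivatives at `t` are those of
`v` (`Filter.EventuallyEq.iteratedDeriv_eq`), and its bound `(t−s')^{k/2}(t−s')^l‖Dᵏ∂ₜˡ‖ ≤ C_L M` is the claim with
`K = C_L C' √2/(√δ^k δ^l)`.

Corollaries (per profile): `exists_deriv_rate_of_class` (`‖∂ₜv(t,y)‖ ≤ K/((−t)√(−t))` — K2-p2's ask),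
`exists_iteratedFDeriv_rate_of_class` (every space order), `exists_iteratedFDeriv_three_rate_of_class`
(`‖D³v‖ ≤ K/(−t)²`), `exists_fderiv_deriv_rate_of_class` (`‖Dₓ∂ₜv‖ ≤ K/(−t)²`), and — consuming the Navier–Stokes
equation — `exists_pressureGradient_rate_of_class`: for ANY classical pressure `p` of the profile on a window `(t₀,0)`
(the tree's `IsTypeIAncientMild.exists_isClassicalNSSolutionOn_Ioo` provides one), `‖∇p(t,y)‖ ≤ K_p/((−t)√(−t))` with
`K_p = 3K₂₀ + K₀₁ + C·K₁₀` depending on `C` only (`∇p = Δv − ∂ₜv − (v·∇)v`, `‖Δv‖ ≤ 3‖D²v‖`).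

WHAT THIS IS NOT: not a claim about Navier–Stokes regularity and not the crux — scale-sharp regularity rates of the
route's profile class (bears_on LADDER-NS N0, route PoloidalWindowDoor, crux K2; `--supports` the K2 item).
-/

noncomputable section

-- the summit and its single sub-problem share the name (CONVENTIONS §1), as in every Theorems file
set_option linter.dupNamespace false

namespace Summit.NavierStokesRegularity.NavierStokesRegularity.Theorems.PoloidalWindowDoorPoloidalWindowRigidityClassSpaceTimeRates

open MeasureTheory Set Function Filter Topology Metric
open scoped ENNReal Laplacian
open Literature.Analysis Literature.Analysis.FluidPDE
open Summit.NavierStokesRegularity.NavierStokesRegularity.Theorems.LocalSineTubeDoorProfileAlignedWindowRigidityAncient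

/-! ### the universal space–time rate -/

/-- **SPACE–TIME CLASS RATES (universal constant).**  For every Type-I constant `C` and every space order `k` and time
order `l` there is `K ≥ 0` such that every profile of the route's Type-I class satisfies
`‖Dₓᵏ(∂ₜˡ v)(t,y)‖ ≤ K/√(−t)^{k+2l+1}` for all `t < 0`, `y` (KNSS 2009 Prop. 4.1 for `(k,l)` with its uniform
constants, restarted at the datum time `(1+δ)t`). -/
theorem exists_spaceTime_rate_of_class (C : ℝ) (k l : ℕ) :
    ∃ K : ℝ, 0 ≤ K ∧ ∀ (v : ℝ → EuclideanSpace ℝ (Fin 3) → EuclideanSpace ℝ (Fin 3)),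
      HasTypeITimeDecay C v → ContinuousOn (uncurry v) (Iio (0 : ℝ) ×ˢ univ) →
      (∀ s t : ℝ, s < t → t < 0 → ∀ y,
        v t y = UnboundedOperators.heatExtension (v s) (t - s) y - oseenDuhamel 1 s v v t y) →
      ∀ t < 0, ∀ y, ‖iteratedFDeriv ℝ k (fun y => iteratedDeriv l (fun τ => v τ y) t) y‖ ≤
        K / Real.sqrt (-t) ^ (k + 2 * l + 1) := by
  -- the UNIFORM constants of the local smoothing fact for `(k, l)`
  obtain ⟨ε, hε, CL, hCL, hL⟩ := knss2009_local_smoothing_holds (EuclideanSpace ℝ (Fin 3)) k l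
  set C' : ℝ := max C 1 with hC'
  have hC'1 : 1 ≤ C' := le_max_right _ _
  have hC'0 : 0 < C' := lt_of_lt_of_le one_pos hC'1
  have hCC' : C ≤ C' := le_max_left _ _
  set δ : ℝ := ε / (4 * C' ^ 2) with hδ
  have hδ0 : 0 < δ := div_pos hε (by positivity)
  refine ⟨CL * C' * Real.sqrt 2 / (Real.sqrt δ ^ k * δ ^ l), by positivity, fun v hrate hcont hmild t ht y => ?_⟩
  have hnt : 0 < -t := neg_pos.2 ht
  -- datum time `s' = (1+δ) t`, window `(s', t/2)`, bound `M = C' √2 / √(−t)`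
  set s' : ℝ := t - δ * (-t) with hs'
  have hs't : s' < t := by rw [hs']; nlinarith
  have hs'0 : s' < 0 := hs't.trans ht
  have hT : s' < t / 2 := by linarith
  set M : ℝ := C' * Real.sqrt 2 / Real.sqrt (-t) with hM
  have hsq0 : 0 < Real.sqrt (-t) := Real.sqrt_pos.2 hnt
  have hM0 : 0 < M := div_pos (mul_pos hC'0 (Real.sqrt_pos.2 two_pos)) hsq0
  -- the Type-I rate gives `‖v τ‖ ≤ M` for `τ < t/2`
  have hbound : ∀ τ < t / 2, ∀ x, ‖v τ x‖ ≤ M := by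
    intro τ hτ x
    have hτ0 : τ < 0 := by linarith
    refine (hrate τ hτ0 x).trans ?_
    have h1 : C / Real.sqrt (-τ) ≤ C' / Real.sqrt (-τ) :=
      div_le_div_of_nonneg_right hCC' (Real.sqrt_nonneg _)
    refine h1.trans ?_
    rw [hM, div_le_div_iff₀ (Real.sqrt_pos.2 (by linarith)) hsq0]
    have h2 : Real.sqrt (-t) ≤ Real.sqrt 2 * Real.sqrt (-τ) := by
      rw [← Real.sqrt_mul (by norm_num : (0:ℝ) ≤ 2)]
      exact Real.sqrt_le_sqrt (by linarith)
    calc C' * Real.sqrt (-t) ≤ C' * (Real.sqrt 2 * Real.sqrt (-τ)) :=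
          mul_le_mul_of_nonneg_left h2 hC'0.le
      _ = C' * Real.sqrt 2 * Real.sqrt (-τ) := by ring
  -- hypotheses of the local representative lemma on the window `(s', t/2)` with datum `v s'`
  have ha : AEStronglyMeasurable (v s') volume := (continuous_slice hcont hs'0).aestronglyMeasurable
  have haM : eLpNorm (v s') ∞ volume ≤ ENNReal.ofReal M := by
    rw [eLpNorm_exponent_top]
    exact eLpNormEssSup_le_of_ae_bound (Eventually.of_forall fun x => hbound _ (by linarith) x)
  have hsub : Ioo s' (t / 2) ×ˢ (univ : Set (EuclideanSpace ℝ (Fin 3))) ⊆ Iio 0 ×ˢ univ :=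
    prod_mono (fun τ hτ => lt_trans hτ.2 (by linarith)) subset_rfl
  have hu : AEStronglyMeasurable (uncurry v) (volume.restrict (Ioo s' (t / 2) ×ˢ univ)) :=
    (hcont.mono hsub).aestronglyMeasurable (measurableSet_Ioo.prod MeasurableSet.univ)
  have hub : ∀ τ ∈ Ioo s' (t / 2), eLpNorm (v τ) ∞ volume ≤ ENNReal.ofReal M := by
    intro τ hτ
    rw [eLpNorm_exponent_top]
    exact eLpNormEssSup_le_of_ae_bound (Eventually.of_forall fun x => hbound τ hτ.2 x)
  have hmild' : ∀ τ ∈ Ioo s' (t / 2), v τ =ᵐ[volume] fun x =>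
      UnboundedOperators.heatExtension (v s') (1 * (τ - s')) x - oseenDuhamel 1 s' v v τ x := fun τ hτ =>
    Eventually.of_forall fun x => by
      rw [one_mul]; exact hmild s' τ hτ.1 (by linarith [hτ.2]) x
  obtain ⟨w, -, -, hrep, -, hbd⟩ :=
    exists_local_smooth_representative hL one_pos hM0 hCL ha haM hu hub hmild'
  -- `t` lies in the local window `(s', s' + ε/M²)`: `t − s' = δ(−t) < ε(−t)/(2C'²) = ε/M²`
  have hM2 : M ^ 2 = 2 * C' ^ 2 / (-t) := by
    rw [hM, div_pow, mul_pow, Real.sq_sqrt (by norm_num : (0:ℝ) ≤ 2), Real.sq_sqrt hnt.le]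
    ring
  have hq : ε * 1 / M ^ 2 = ε * (-t) / (2 * C' ^ 2) := by
    rw [hM2]
    field_simp
  have hδlt : δ * (-t) < ε * (-t) / (2 * C' ^ 2) := by
    rw [hδ, lt_div_iff₀ (by positivity)]
    have h1 : ε / (4 * C' ^ 2) * -t * (2 * C' ^ 2) = ε * -t / 2 := by
      field_simp
      ring
    rw [h1]
    linarith [mul_pos hε hnt]
  have hwin : t < s' + ε * 1 / M ^ 2 := by
    rw [hq, hs']
    linarith
  have htmem : t ∈ Ioo s' (min (s' + ε * 1 / M ^ 2) (t / 2)) := ⟨hs't, lt_min hwin (by linarith)⟩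
  have htmem' : t ∈ Ioo s' (s' + ε * 1 / M ^ 2) := ⟨hs't, hwin⟩
  -- the representative IS `v` on the OPEN time interval `(s', min (s' + ε/M²) (t/2)) ∋ t`
  have hvw : ∀ τ ∈ Ioo s' (min (s' + ε * 1 / M ^ 2) (t / 2)), ∀ x, v τ x = w τ x := by
    intro τ hτ x
    have hτ2 : τ < t / 2 := lt_of_lt_of_le hτ.2 (min_le_right _ _)
    rw [← hrep τ hτ x, one_mul]
    exact hmild s' τ hτ.1 (by linarith) x
  -- hence the mixed derivatives of `w` and `v` at time `t` agree, at every point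
  have hfun : (fun y' => iteratedDeriv l (fun τ => w τ y') t) = fun y' => iteratedDeriv l (fun τ => v τ y') t := by
    funext y'
    refine Filter.EventuallyEq.iteratedDeriv_eq l ?_
    filter_upwards [isOpen_Ioo.mem_nhds htmem] with τ hτ
    exact (hvw τ hτ y').symm
  -- the bound of the local solution at time `t`
  have h := hbd t htmem' y
  rw [hfun, one_mul] at h
  have hts : t - s' = δ * (-t) := by rw [hs']; ring
  -- `(t − s')^{k/2} = (√δ √(−t))^k`, `(t − s')^l = (δ (−t))^l = δ^l √(−t)^{2l}`
  have hhalf : (t - s') ^ ((k : ℝ) / 2) = (Real.sqrt δ * Real.sqrt (-t)) ^ k := by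
    rw [Real.rpow_div_two_eq_sqrt _ (by rw [hts]; positivity), Real.rpow_natCast, hts,
      Real.sqrt_mul hδ0.le]
  have hfull : (t - s') ^ l = δ ^ l * Real.sqrt (-t) ^ (2 * l) := by
    rw [hts, mul_pow, pow_mul, Real.sq_sqrt hnt.le]
  rw [hhalf, hfull] at h
  -- collect: `√δ^k δ^l √(−t)^{k+2l} ‖F‖ ≤ CL M = CL C' √2/√(−t)`
  have hA : 0 < Real.sqrt (-t) ^ (k + 2 * l + 1) := pow_pos hsq0 _
  have hD : 0 < Real.sqrt δ ^ k * δ ^ l := mul_pos (pow_pos (Real.sqrt_pos.2 hδ0) _) (pow_pos hδ0 _)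
  rw [le_div_iff₀ hA, le_div_iff₀ hD]
  have hrew : (Real.sqrt δ * Real.sqrt (-t)) ^ k * (δ ^ l * Real.sqrt (-t) ^ (2 * l)) *
      ‖iteratedFDeriv ℝ k (fun y' => iteratedDeriv l (fun τ => v τ y') t) y‖ * Real.sqrt (-t) =
      ‖iteratedFDeriv ℝ k (fun y' => iteratedDeriv l (fun τ => v τ y') t) y‖ * Real.sqrt (-t) ^ (k + 2 * l + 1) *
        (Real.sqrt δ ^ k * δ ^ l) := by
    rw [mul_pow]; ring
  have h2 : (Real.sqrt δ * Real.sqrt (-t)) ^ k * (δ ^ l * Real.sqrt (-t) ^ (2 * l)) *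
      ‖iteratedFDeriv ℝ k (fun y' => iteratedDeriv l (fun τ => v τ y') t) y‖ * Real.sqrt (-t) ≤
      CL * M * Real.sqrt (-t) := mul_le_mul_of_nonneg_right h hsq0.le
  rw [hrew] at h2
  refine h2.trans (le_of_eq ?_)
  rw [hM]
  field_simp

/-! ### per-profile corollaries -/

variable {C : ℝ} {v : ℝ → EuclideanSpace ℝ (Fin 3) → EuclideanSpace ℝ (Fin 3)}

/-- **Every space order**: `‖Dᵏv(t)(y)‖ ≤ K/√(−t)^{k+1}` on the class (`l = 0`). -/
theorem exists_iteratedFDeriv_rate_of_class (k : ℕ) (hrate : HasTypeITimeDecay C v)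
    (hcont : ContinuousOn (uncurry v) (Iio (0 : ℝ) ×ˢ univ))
    (hmild : ∀ s t : ℝ, s < t → t < 0 → ∀ y,
      v t y = UnboundedOperators.heatExtension (v s) (t - s) y - oseenDuhamel 1 s v v t y) :
    ∃ K : ℝ, 0 ≤ K ∧ ∀ t < 0, ∀ y, ‖iteratedFDeriv ℝ k (v t) y‖ ≤ K / Real.sqrt (-t) ^ (k + 1) := by
  obtain ⟨K, hK0, hK⟩ := exists_spaceTime_rate_of_class C k 0
  refine ⟨K, hK0, fun t ht y => ?_⟩
  have h := hK v hrate hcont hmild t ht y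
  have hid : (fun y' => iteratedDeriv 0 (fun τ => v τ y') t) = v t := by
    funext y'; rw [iteratedDeriv_zero]
  simpa [hid] using h

/-- **THE TIME-DERIVATIVE RATE** (K2-p2's ask): `‖∂ₜv(t,y)‖ ≤ K/((−t)√(−t))` on the class, one `K ≥ 0` per profile
(in fact per `C`). -/
theorem exists_deriv_rate_of_class (hrate : HasTypeITimeDecay C v)
    (hcont : ContinuousOn (uncurry v) (Iio (0 : ℝ) ×ˢ univ))
    (hmild : ∀ s t : ℝ, s < t → t < 0 → ∀ y,
      v t y = UnboundedOperators.heatExtension (v s) (t - s) y - oseenDuhamel 1 s v v t y) :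
    ∃ K : ℝ, 0 ≤ K ∧ ∀ t < 0, ∀ y, ‖deriv (fun τ => v τ y) t‖ ≤ K / ((-t) * Real.sqrt (-t)) := by
  obtain ⟨K, hK0, hK⟩ := exists_spaceTime_rate_of_class C 0 1
  refine ⟨K, hK0, fun t ht y => ?_⟩
  have h := hK v hrate hcont hmild t ht y
  rw [norm_iteratedFDeriv_zero, iteratedDeriv_one] at h
  have h3 : Real.sqrt (-t) ^ (0 + 2 * 1 + 1) = (-t) * Real.sqrt (-t) := by
    rw [show 0 + 2 * 1 + 1 = 3 by norm_num, pow_succ, Real.sq_sqrt (neg_pos.2 ht).le]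
  rwa [h3] at h

/-- **The mixed rate** `‖Dₓ(∂ₜv)(t,y)‖ ≤ K/(−t)²` on the class. -/
theorem exists_fderiv_deriv_rate_of_class (hrate : HasTypeITimeDecay C v)
    (hcont : ContinuousOn (uncurry v) (Iio (0 : ℝ) ×ˢ univ))
    (hmild : ∀ s t : ℝ, s < t → t < 0 → ∀ y,
      v t y = UnboundedOperators.heatExtension (v s) (t - s) y - oseenDuhamel 1 s v v t y) :
    ∃ K : ℝ, 0 ≤ K ∧ ∀ t < 0, ∀ y, ‖fderiv ℝ (fun y => deriv (fun τ => v τ y) t) y‖ ≤ K / (-t) ^ 2 := by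
  obtain ⟨K, hK0, hK⟩ := exists_spaceTime_rate_of_class C 1 1
  refine ⟨K, hK0, fun t ht y => ?_⟩
  have h := hK v hrate hcont hmild t ht y
  have hfun : (fun y' => iteratedDeriv 1 (fun τ => v τ y') t) = fun y' => deriv (fun τ => v τ y') t := by
    funext y'; rw [iteratedDeriv_one]
  rw [hfun, norm_iteratedFDeriv_one] at h
  have h4 : Real.sqrt (-t) ^ (1 + 2 * 1 + 1) = (-t) ^ 2 := by
    rw [show 1 + 2 * 1 + 1 = 2 * 2 by norm_num, pow_mul, Real.sq_sqrt (neg_pos.2 ht).le]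
  rwa [h4] at h

/-- **The third-derivative rate** `‖D³v(t)(y)‖ ≤ K/(−t)²` on the class. -/
theorem exists_iteratedFDeriv_three_rate_of_class (hrate : HasTypeITimeDecay C v)
    (hcont : ContinuousOn (uncurry v) (Iio (0 : ℝ) ×ˢ univ))
    (hmild : ∀ s t : ℝ, s < t → t < 0 → ∀ y,
      v t y = UnboundedOperators.heatExtension (v s) (t - s) y - oseenDuhamel 1 s v v t y) :
    ∃ K : ℝ, 0 ≤ K ∧ ∀ t < 0, ∀ y, ‖iteratedFDeriv ℝ 3 (v t) y‖ ≤ K / (-t) ^ 2 := by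
  obtain ⟨K, hK0, hK⟩ := exists_iteratedFDeriv_rate_of_class 3 hrate hcont hmild
  refine ⟨K, hK0, fun t ht y => ?_⟩
  have h := hK t ht y
  have h4 : Real.sqrt (-t) ^ (3 + 1) = (-t) ^ 2 := by
    rw [show 3 + 1 = 2 * 2 by norm_num, pow_mul, Real.sq_sqrt (neg_pos.2 ht).le]
  rwa [h4] at h

/-- The second-derivative rate in the `√`-free form `‖D²v(t)(y)‖ ≤ K/((−t)√(−t))` (same constant shape as the tree's
`…VerticalMean.exists_iteratedFDeriv_two_rate_of_class`, re-derived from the universal rate for use below). -/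
theorem exists_iteratedFDeriv_two_rate_of_class' (hrate : HasTypeITimeDecay C v)
    (hcont : ContinuousOn (uncurry v) (Iio (0 : ℝ) ×ˢ univ))
    (hmild : ∀ s t : ℝ, s < t → t < 0 → ∀ y,
      v t y = UnboundedOperators.heatExtension (v s) (t - s) y - oseenDuhamel 1 s v v t y) :
    ∃ K : ℝ, 0 ≤ K ∧ ∀ t < 0, ∀ y, ‖iteratedFDeriv ℝ 2 (v t) y‖ ≤ K / ((-t) * Real.sqrt (-t)) := by
  obtain ⟨K, hK0, hK⟩ := exists_iteratedFDeriv_rate_of_class 2 hrate hcont hmild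
  refine ⟨K, hK0, fun t ht y => ?_⟩
  have h := hK t ht y
  have h3 : Real.sqrt (-t) ^ (2 + 1) = (-t) * Real.sqrt (-t) := by
    rw [pow_succ, Real.sq_sqrt (neg_pos.2 ht).le]
  rwa [h3] at h

/-- The first-derivative rate `‖Dv(t)(y)‖ ≤ K/(−t)` with `K ≥ 0` (the tree's `…ClassRate.exists_fderiv_rate_of_class`
re-derived from the universal rate, with the sign of the constant recorded). -/
theorem exists_fderiv_rate_of_class' (hrate : HasTypeITimeDecay C v)
    (hcont : ContinuousOn (uncurry v) (Iio (0 : ℝ) ×ˢ univ))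
    (hmild : ∀ s t : ℝ, s < t → t < 0 → ∀ y,
      v t y = UnboundedOperators.heatExtension (v s) (t - s) y - oseenDuhamel 1 s v v t y) :
    ∃ K : ℝ, 0 ≤ K ∧ ∀ t < 0, ∀ y, ‖fderiv ℝ (v t) y‖ ≤ K / (-t) := by
  obtain ⟨K, hK0, hK⟩ := exists_iteratedFDeriv_rate_of_class 1 hrate hcont hmild
  refine ⟨K, hK0, fun t ht y => ?_⟩
  have h := hK t ht y
  rw [← norm_iteratedFDeriv_one (𝕜 := ℝ)]
  have h2 : Real.sqrt (-t) ^ (1 + 1) = -t := by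
    rw [show 1 + 1 = 2 by norm_num, Real.sq_sqrt (neg_pos.2 ht).le]
  rwa [h2] at h

/-! ### the pressure-gradient rate (consumes the Navier–Stokes equation) -/

/-- **THE PRESSURE-GRADIENT RATE.**  For a profile of the class and ANY classical pressure `p` for it on a window
`(t₀, 0)` (unit viscosity, zero force), `‖∇p(t,y)‖ ≤ K/((−t)√(−t))` for `t ∈ (t₀,0)`, with `K` independent of the
window and of the pressure: `∇p = Δv − ∂ₜv − (v·∇)v`, `‖Δv‖ ≤ 3‖D²v‖`, and the class rates. -/
theorem exists_pressureGradient_rate_of_class (hrate : HasTypeITimeDecay C v)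
    (hcont : ContinuousOn (uncurry v) (Iio (0 : ℝ) ×ˢ univ))
    (hmild : ∀ s t : ℝ, s < t → t < 0 → ∀ y,
      v t y = UnboundedOperators.heatExtension (v s) (t - s) y - oseenDuhamel 1 s v v t y) :
    ∃ K : ℝ, 0 ≤ K ∧ ∀ (t₀ : ℝ) (p : ℝ → EuclideanSpace ℝ (Fin 3) → ℝ),
      IsClassicalNSSolutionOn (Ioo t₀ 0) 1 0 v p →
      ∀ t ∈ Ioo t₀ 0, ∀ y, ‖gradient (p t) y‖ ≤ K / ((-t) * Real.sqrt (-t)) := by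
  obtain ⟨K₂, hK₂0, hK₂⟩ := exists_iteratedFDeriv_two_rate_of_class' hrate hcont hmild
  obtain ⟨K₁, hK₁0, hK₁⟩ := exists_fderiv_rate_of_class' hrate hcont hmild
  obtain ⟨Kₜ, hKₜ0, hKₜ⟩ := exists_deriv_rate_of_class hrate hcont hmild
  have hC0 : 0 ≤ max C 0 := le_max_right _ _
  refine ⟨3 * K₂ + Kₜ + max C 0 * K₁, by positivity, fun t₀ p hns t ht y => ?_⟩
  have ht0 : t < 0 := ht.2
  have hnt : 0 < -t := neg_pos.2 ht0
  have hsq : 0 < Real.sqrt (-t) := Real.sqrt_pos.2 hnt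
  have hden : 0 < (-t) * Real.sqrt (-t) := mul_pos hnt hsq
  -- the momentum equation at `(t, y)`: `∂ₜv + (v·∇)v = Δv − ∇p`
  have hmom := hns.momentum t ht y
  simp only [one_smul, Pi.zero_apply, add_zero] at hmom
  have hgrad : gradient (p t) y = (Δ (v t)) y - timeDerivWithin (Ioo t₀ 0) v t y - convect (v t) (v t) y := by
    rw [eq_sub_iff_add_eq] at hmom
    rw [← hmom]; abel
  -- the time derivative within the open window is the plain derivative
  have htd : timeDerivWithin (Ioo t₀ 0) v t y = deriv (fun τ => v τ y) t := by
    rw [timeDerivWithin, derivWithin_of_isOpen isOpen_Ioo ht]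
  -- the three bounds
  have hv2 : ContDiff ℝ 2 (v t) := (hns.contDiff_velocity ht).of_le (by norm_cast)
  have hΔ : ‖(Δ (v t)) y‖ ≤ 3 * (K₂ / ((-t) * Real.sqrt (-t))) :=
    (norm_laplacian_le_three_mul_norm_iteratedFDeriv_two hv2 y).trans
      (mul_le_mul_of_nonneg_left (hK₂ t ht0 y) (by norm_num))
  have hdt : ‖timeDerivWithin (Ioo t₀ 0) v t y‖ ≤ Kₜ / ((-t) * Real.sqrt (-t)) := by
    rw [htd]; exact hKₜ t ht0 y
  have hcv : ‖convect (v t) (v t) y‖ ≤ max C 0 * K₁ / ((-t) * Real.sqrt (-t)) := by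
    rw [convect]
    refine (ContinuousLinearMap.le_opNorm _ _).trans ?_
    have h1 := hK₁ t ht0 y
    have h2 : ‖v t y‖ ≤ max C 0 / Real.sqrt (-t) :=
      (hrate t ht0 y).trans (div_le_div_of_nonneg_right (le_max_left _ _) hsq.le)
    calc ‖fderiv ℝ (v t) y‖ * ‖v t y‖ ≤ (K₁ / (-t)) * (max C 0 / Real.sqrt (-t)) :=
          mul_le_mul h1 h2 (norm_nonneg _) (div_nonneg hK₁0 hnt.le)
      _ = max C 0 * K₁ / ((-t) * Real.sqrt (-t)) := by
          field_simp
  calc ‖gradient (p t) y‖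
      = ‖(Δ (v t)) y - timeDerivWithin (Ioo t₀ 0) v t y - convect (v t) (v t) y‖ := by rw [hgrad]
    _ ≤ ‖(Δ (v t)) y‖ + ‖timeDerivWithin (Ioo t₀ 0) v t y‖ + ‖convect (v t) (v t) y‖ :=
          (norm_sub_le _ _).trans (by gcongr; exact norm_sub_le _ _)
    _ ≤ 3 * (K₂ / ((-t) * Real.sqrt (-t))) + Kₜ / ((-t) * Real.sqrt (-t)) +
          max C 0 * K₁ / ((-t) * Real.sqrt (-t)) := add_le_add (add_le_add hΔ hdt) hcv
    _ = (3 * K₂ + Kₜ + max C 0 * K₁) / ((-t) * Real.sqrt (-t)) := by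
          rw [mul_div_assoc]
          ring

end Summit.NavierStokesRegularity.NavierStokesRegularity.Theorems.PoloidalWindowDoorPoloidalWindowRigidityClassSpaceTimeRates

end
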